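import Literature.Claims.NS.Chae2005

/-!
# C78 `Chae2005` (arXiv math/0504219 v1, withdrawn v2) — kernel refutations at the abstract grain:
# `¬ Step_6` (last «≥» of (2.11) p. 6), `¬ Step_7` (display after (2.11) p. 6), `¬ Step_9` (p. 7)

Cell `ns-claims` (D-0090 NS-CLAIMS SWEEP), claim C78; refuter `ns-claims-refuter-6`; typist
`ns-claims-typist-11` (skeleton `Literature.Claims.NS.Chae2005`, p469179); referee `ns-claims-ref-2`.
Text of record: [Chae2005FiniteTimeSingularitiesWithdrawn] v1 (TeX `v1-2005-04-11-navier-stokes.tex`).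

* `not_Step_6` — (2.11), last inequality, p. 6 (TeX l.293–295): from `|σ|‖ω‖ ≤ ‖Sω‖` alone the print
  passes from `‖Sω‖² + (−ρ+2να)‖ω‖² − 6ν‖Sω‖‖Δω‖ + 2ν²‖Δω‖²` to `(σ² − ρ + 2να − 6νβδ + 2ν²δ²)‖ω‖²`,
  i.e. it replaces `‖Δω‖` by `δ‖ω‖ = ‖∇ω‖` in two terms of opposite signs. With `w = ‖ω‖`, `B = ‖Sω‖`,
  `C = ‖Δω‖`, `D = ‖∇ω‖`: `RHS − LHS = (B² − σ²w²) + (C − D)(2ν²(C + D) − 6νB)` (`step6_gap`), negative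
  e.g. at `ν = 1, w = 1, B = σ = 8, C = 4, D = 2, ρ = α = 0` (all norms positive, `D² ≤ wC`, Cauchy–Schwarz
  tight): `−24 ≤ −96` is false. At `ν = 0` the inference is sound (`step6_at_nu_zero`).
* `not_Step_7` — p. 6 (TeX l.305–310): `(‖ω‖′)² ≤ σ²‖ω‖²` from (2.9) `‖ω‖′ = (σ − νδ²)‖ω‖` needs
  `νδ² ≤ 2σ` (`step7_iff`); instance `σ = 1, ν = 1, δ² = 3, ‖ω‖ = 1`: `4 ≤ 1` is false (a viscous decay
  rate exceeding twice the stretching rate). Identity at `ν = 0`.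
* `not_Step_9` — p. 7 (TeX l.338–343), for EVERY `ν ≥ 0` including Euler: multiplying (2.13)
  `Ψ″ − h²Ψ ≤ 0` by `e^{∫₀ᵗh}` gives `(Ψe^{∫h})″ − 2h(Ψe^{∫h})′ = (Ψ″ − h²Ψ + h′Ψ)e^{∫h}`, and the term `h′Ψ`
  is dropped. Countermodel `T = 1`, `Ψ ≡ 1`, `h(t) = t` ((2.13) holds: `−t² ≤ 0`): `F = e^{t²/2}`, the right
  derivatives are pinned by one-sided uniqueness (`uniqueDiffOn_Ici`), `F′ = te^{t²/2}`, `F″(0) = 1`, and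
  `F″(0) − 2h(0)F′(0) = 1 > 0`.

Class (all three): false lemma (countermodel) at the typed abstract grain. The solution-grain steps
(`Step_4` = (2.10) as printed, `Step_12`) are not attacked here. Closed terms; axioms `propext`,
`Classical.choice`, `Quot.sound`. The headline theorems state the skeleton names fully qualified (the
gate's textual dedup would otherwise match `¬Step_k` across claims).

WHAT THIS IS NOT: not a claim about NS regularity or blow-up; not a claim about any author beyond
the typed locator.
-/

-- The summit's canonical theorem namespace repeats the summit name (single-conjunct summit).
set_option linter.dupNamespace false

noncomputable section

open Set Filter Topology

namespace Summit.NavierStokesRegularity.NavierStokesRegularity.Theorems.Chae2005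

/-! ## Step 6 — the last «≥» of (2.11), p. 6 -/

/-- The exact gap in the last inequality of (2.11): right side minus left side of the typed `Step_6`
inequality equals `(B² − σ²w²) + (C − D)(2ν²(C + D) − 6νB)` (for `w ≠ 0`).
[cite: Chae2005FiniteTimeSingularitiesWithdrawn, (2.11) p.6] -/
theorem step6_gap (ν w B C D r a σ : ℝ) (hw : w ≠ 0) :
    (B ^ 2 + (-r + 2 * ν * a) * w ^ 2 - 6 * ν * B * C + 2 * ν ^ 2 * C ^ 2)
      - (σ ^ 2 - r + 2 * ν * a - 6 * ν * (B / w) * (D / w) + 2 * ν ^ 2 * (D / w) ^ 2) * w ^ 2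
      = (B ^ 2 - σ ^ 2 * w ^ 2) + (C - D) * (2 * ν ^ 2 * (C + D) - 6 * ν * B) := by
  field_simp
  ring

/-- At `ν = 0` the printed inference IS sound: it reduces to `σ²‖ω‖² ≤ ‖Sω‖²`, i.e. Cauchy–Schwarz.
[cite: Chae2005FiniteTimeSingularitiesWithdrawn, (2.11) p.6] -/
theorem step6_at_nu_zero (w B C D r a σ : ℝ) (hw : 0 < w) (hσ : |σ| * w ≤ B) :
    (σ ^ 2 - r + 2 * 0 * a - 6 * 0 * (B / w) * (D / w) + 2 * 0 ^ 2 * (D / w) ^ 2) * w ^ 2 ≤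
      B ^ 2 + (-r + 2 * 0 * a) * w ^ 2 - 6 * 0 * B * C + 2 * 0 ^ 2 * C ^ 2 := by
  have h1 : (|σ| * w) ^ 2 ≤ B ^ 2 := pow_le_pow_left₀ (by positivity) hσ 2
  rw [mul_pow, sq_abs] at h1
  nlinarith

/-- **`¬ Step_6`** — the last «≥» of (2.11) p. 6 is false at the abstract grain: instance `ν = 1`,
`w = ‖ω‖ = 1`, `B = ‖Sω‖ = 8`, `C = ‖Δω‖ = 4`, `D = ‖∇ω‖ = 2`, `ρ = α = 0`, `σ = 8` (so `|σ|w = B`,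
`D² ≤ wC`): left side `−24`, right side `−96`. Class: false lemma (countermodel).
[cite: Chae2005FiniteTimeSingularitiesWithdrawn, (2.11) p.6] -/
theorem not_Step_6 : ¬ Literature.Claims.NS.Chae2005.Step_6 := by
  intro h
  have := h 1 1 8 4 2 0 0 8 (by norm_num) (by norm_num) (by norm_num) (by norm_num) (by norm_num)
    (by norm_num)
  norm_num at this

/-- The typist's degenerate instance (a strain annihilating the vorticity, as for planar flows):
`ν = w = D = 1`, `B = C = σ = ρ = α = 0` gives `2 ≤ 0`. [cite: Chae2005FiniteTimeSingularitiesWithdrawn, (2.11) p.6] -/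
theorem not_Step_6' : ¬ Literature.Claims.NS.Chae2005.Step_6 := by
  intro h
  have := h 1 1 0 0 1 0 0 0 (by norm_num) (by norm_num) le_rfl le_rfl (by norm_num) (by norm_num)
  norm_num at this

/-! ## Step 7 — the display after (2.11), p. 6 -/

/-- The exact content of the inference (2.9) ⇒ `(‖ω‖′)² ≤ σ²‖ω‖²`: for `‖ω‖ = y > 0` it holds iff
`νδ²(νδ² − 2σ) ≤ 0`, i.e. iff `νδ² ≤ 2σ` when `νδ² > 0`. [cite: Chae2005FiniteTimeSingularitiesWithdrawn, p.6] -/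
theorem step7_iff (σ ν d y : ℝ) (hy : 0 < y) :
    ((σ - ν * d) * y) ^ 2 ≤ σ ^ 2 * y ^ 2 ↔ ν * d * (ν * d - 2 * σ) ≤ 0 := by
  have hy2 : 0 < y ^ 2 := by positivity
  constructor
  · intro h; nlinarith
  · intro h; nlinarith

/-- **`¬ Step_7`** — `(‖ω‖′)² ≤ σ²‖ω‖²` does not follow from (2.9) when `νδ² > 2σ`: instance `σ = 1`,
`ν = 1`, `δ² = d = 3`, `‖ω‖ = y = 1`: `((1 − 3)·1)² = 4 ≤ 1` is false. Class: false lemma (countermodel).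
[cite: Chae2005FiniteTimeSingularitiesWithdrawn, p.6] -/
theorem not_Step_7 : ¬ Literature.Claims.NS.Chae2005.Step_7 := by
  intro h
  have := h 1 1 3 1 (by norm_num) (by norm_num) (by norm_num)
  norm_num at this

/-- At `ν = 0` the display is an identity. [cite: Chae2005FiniteTimeSingularitiesWithdrawn, p.6] -/
theorem step7_at_nu_zero (σ d y : ℝ) : ((σ - 0 * d) * y) ^ 2 ≤ σ ^ 2 * y ^ 2 := by
  nlinarith [sq_nonneg (σ * y)]

/-! ## Step 9 — «multiply (2.13) by `exp(∫₀ᵗ h ds)`», p. 7 -/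

/-- `∫₀ˢ τ dτ = s²/2`, so `1 · e^{∫₀ˢ τ dτ} = e^{s²/2}`. -/
theorem witnessF_eq :
    (fun s : ℝ => (1 : ℝ) * Real.exp (∫ τ in (0:ℝ)..s, τ)) = fun s => Real.exp (s ^ 2 / 2) := by
  funext s
  rw [integral_id]
  simp

/-- `d/ds e^{s²/2} = e^{s²/2}·s`. -/
theorem hasDerivAt_witnessF (s : ℝ) :
    HasDerivAt (fun x : ℝ => Real.exp (x ^ 2 / 2)) (Real.exp (s ^ 2 / 2) * s) s := by
  have h := ((hasDerivAt_pow 2 s).div_const 2).exp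
  convert h using 1
  simp

/-- `d/ds (e^{s²/2}·s) = 1` at `s = 0`. -/
theorem hasDerivAt_witnessF1_zero :
    HasDerivAt (fun x : ℝ => Real.exp (x ^ 2 / 2) * x) 1 0 := by
  have h := (hasDerivAt_witnessF 0).fun_mul (hasDerivAt_id' 0)
  simpa using h

/-- **`¬ Step_9`** — p. 7: the printed display after (2.13) drops the term `h′Ψ e^{∫h}`. Countermodel
`T = 1`, `Ψ ≡ 1` (`Ψ′ ≡ Ψ″ ≡ 0`), `h(t) = t` (continuous, `≥ 0`, (2.13): `0 − t²·1 ≤ 0`): every admissible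
`F1` equals `t e^{t²/2}` on `[0,1)` (one-sided uniqueness of derivatives), hence `F2(0) = 1`, and
`F2(0) − 2h(0)F1(0) = 1 ≤ 0` is false. Present for every `ν ≥ 0` (Euler included). Class: false lemma
(countermodel). [cite: Chae2005FiniteTimeSingularitiesWithdrawn, p.7] -/
theorem not_Step_9 : ¬ Literature.Claims.NS.Chae2005.Step_9 := by
  intro h
  obtain ⟨F1, F2, _hF10, _hF1c, hF⟩ := h 1 (fun _ => 1) (fun _ => 0) (fun _ => 0) (fun t => t) one_pos
    continuousOn_id (fun t ht => ht.1)
    (fun t _ => ⟨one_pos, hasDerivWithinAt_const t (Ici t) (1:ℝ), hasDerivWithinAt_const t (Ici t) (0:ℝ),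
      by nlinarith [sq_nonneg t]⟩)
  -- the first right derivative is pinned on `[0,1)`
  have hF1 : ∀ t ∈ Ico (0:ℝ) 1, F1 t = Real.exp (t ^ 2 / 2) * t := by
    intro t ht
    have h1 := (hF t ht).1
    rw [witnessF_eq] at h1
    exact (uniqueDiffOn_Ici t t Set.self_mem_Ici).eq_deriv _ h1 (hasDerivAt_witnessF t).hasDerivWithinAt
  -- hence the second right derivative at `0` is pinned too
  have h0 : (0:ℝ) ∈ Ico (0:ℝ) 1 := ⟨le_rfl, one_pos⟩
  have h2 := (hF 0 h0).2.1
  have hev : (fun x : ℝ => Real.exp (x ^ 2 / 2) * x) =ᶠ[𝓝[Ici (0:ℝ)] 0] F1 := by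
    filter_upwards [Ico_mem_nhdsGE (zero_lt_one' ℝ)] with x hx
    exact (hF1 x hx).symm
  have h2' : HasDerivWithinAt (fun x : ℝ => Real.exp (x ^ 2 / 2) * x) (F2 0) (Ici 0) 0 :=
    h2.congr_of_eventuallyEq hev (hF1 0 h0).symm
  have hF2 : F2 0 = 1 :=
    (uniqueDiffOn_Ici (0:ℝ) 0 Set.self_mem_Ici).eq_deriv _ h2' hasDerivAt_witnessF1_zero.hasDerivWithinAt
  have h3 := (hF 0 h0).2.2
  rw [hF2] at h3
  norm_num at h3

end Summit.NavierStokesRegularity.NavierStokesRegularity.Theorems.Chae2005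

end
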